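import Summits.MatrixMultiplication.MatrixMultiplication.Theorems.AbelianSTPPCensusVPCertDefs
import Summits.MatrixMultiplication.MatrixMultiplication.Theorems.AbelianSTPPCensusVPCertU11
import Summits.MatrixMultiplication.MatrixMultiplication.Theorems.AbelianSTPPCensusShapeCertUniverse

/-!
# vP certificate, soundness of the `VPCert` checker (part 1: semantics, universe, decoration, budget cores)

Fork of eng-2's `…ShapeCertSemantics/Universe` for the vP checker `VPCert.checkV` (`…VPCertDefs`, p449349): the records are
`shOfV` (Δ1 gains), so the list-aggregate ↔ multiset-sum dictionary is re-established here (`WfV`, `agg_sum_eqV`, …), with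
the universe lemmas (well-formed, inside `InUniv`, COMPLETE), the decoration lemmas — `sufDec_dom` (ratios per bucket, as
eng-2) and `sufDec_side` (rider D-R1 (iv): the side decoration dominates every pool member) — and the multiset
transcriptions `budget_coreG` / `budget_coreP` of `VPBudget.u11G_budget_core` / `u11P_budget_core` (p427390) with their letter
rotations.  Everything generic of eng-2 (`AdmM`, heredity, caps, `addBin` lemmas, …) is imported, not restated.
Cell mm-stpp, seat mm-stpp-vp-p2 (gen 0), 2026-08-26.
-/

set_option linter.dupNamespace false
set_option autoImplicit false

namespace Summit.MatrixMultiplication.MatrixMultiplication.Theorems.VPCert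

open ShapeCert Multiset


section fields
/-! ### Fields of the record of a triple -/
variable (M : ℕ) (x : ℕ × ℕ × ℕ)

/-- the record of a triple has that triple -/
@[simp] theorem shOfV_tr : (shOfV M x).tr = x := by rcases x with ⟨a, b, c⟩; rfl
/-- field `a` -/ @[simp] theorem shOfV_a : (shOfV M x).a = x.1 := rfl
/-- field `b` -/ @[simp] theorem shOfV_b : (shOfV M x).b = x.2.1 := rfl
/-- field `c` -/ @[simp] theorem shOfV_c : (shOfV M x).c = x.2.2 := rfl
/-- field `V` -/ @[simp] theorem shOfV_V : (shOfV M x).V = vol x := rfl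
/-- field `ab` -/ @[simp] theorem shOfV_ab : (shOfV M x).ab = pab x := rfl
/-- field `bc` -/ @[simp] theorem shOfV_bc : (shOfV M x).bc = pbc x := rfl
/-- field `ca` -/ @[simp] theorem shOfV_ca : (shOfV M x).ca = pca x := rfl
/-- field `wA` -/ @[simp] theorem shOfV_wA : (shOfV M x).wA = wa x := rfl
/-- field `wB` -/ @[simp] theorem shOfV_wB : (shOfV M x).wB = wb x := rfl
/-- field `wC` -/ @[simp] theorem shOfV_wC : (shOfV M x).wC = wc x := rfl
/-- field `g` -/ @[simp] theorem shOfV_g : (shOfV M x).g = gainOf337 (vol x) := rfl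
/-- field `mpp` -/ @[simp] theorem shOfV_mpp : (shOfV M x).mpp = mpp3 x := rfl
/-- field `dab` -/
theorem shOfV_dab : (shOfV M x).dab = vol x - pab x + (if hasLCD (vol x) M x.2.2 then 0 else 1) := rfl
/-- field `dbc` -/
theorem shOfV_dbc : (shOfV M x).dbc = vol x - pbc x + (if hasLCD (vol x) M x.1 then 0 else 1) := rfl
/-- field `dca` -/
theorem shOfV_dca : (shOfV M x).dca = vol x - pca x + (if hasLCD (vol x) M x.2.1 then 0 else 1) := rfl
/-- field `rho` -/
theorem shOfV_rho : (shOfV M x).rho = gainOf337 (vol x) * K / uu x + 1 := rfl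
/-- field `lev` (largest side) -/
theorem shOfV_lev : (shOfV M x).lev = max x.1 (max x.2.1 x.2.2) := rfl

end fields

/-- every record of the list is the vP record of its own triple -/
def WfV (M : ℕ) (l : List Sh) : Prop := ∀ t ∈ l, t = shOfV M t.tr

/-- total Δ1 integer gain of a shape multiset -/
def gsum337 (G : Multiset (ℕ × ℕ × ℕ)) : ℕ := (G.map fun x => gainOf337 (vol x)).sum
/-- `Σ V` of a shape multiset -/
def svM (G : Multiset (ℕ × ℕ × ℕ)) : ℕ := (G.map vol).sum
/-- full fibre sum of form A: `Σ a · min(c, b)` -/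
def laM (G : Multiset (ℕ × ℕ × ℕ)) : ℕ := (G.map fun x => x.1 * min x.2.2 x.2.1).sum
/-- full fibre sum of form B: `Σ b · min(a, c)` -/
def lbM (G : Multiset (ℕ × ℕ × ℕ)) : ℕ := (G.map fun x => x.2.1 * min x.1 x.2.2).sum
/-- full fibre sum of form C: `Σ c · min(b, a)` -/
def lcM (G : Multiset (ℕ × ℕ × ℕ)) : ℕ := (G.map fun x => x.2.2 * min x.2.1 x.1).sum

section aggregates
/-! ### List aggregates of a well-formed prefix are multiset sums -/
variable {M : ℕ} {fam : List Sh}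

/-- a list aggregate of a well-formed prefix is the multiset sum of the matching triple function -/
theorem agg_sum_eqV (hw : WfV M fam) (f : Sh → ℕ) (g : ℕ × ℕ × ℕ → ℕ) (hfg : ∀ x, f (shOfV M x) = g x) :
    (fam.map f).sum = ((famT fam).map g).sum := by
  unfold famT
  rw [Multiset.map_coe, Multiset.sum_coe, List.map_map]
  congr 1
  apply List.map_congr_left
  intro t ht
  simp only [Function.comp_apply]
  rw [← hfg t.tr, ← hw t ht]

/-- `gs` -/ theorem gs_eqV (hw : WfV M fam) : gs fam = gsum337 (famT fam) := agg_sum_eqV hw _ _ (shOfV_g M)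
/-- `sA` -/ theorem sA_eqV (hw : WfV M fam) : sA fam = ((famT fam).map wa).sum := agg_sum_eqV hw _ _ (shOfV_wA M)
/-- `sB` -/ theorem sB_eqV (hw : WfV M fam) : sB fam = ((famT fam).map wb).sum := agg_sum_eqV hw _ _ (shOfV_wB M)
/-- `sC` -/ theorem sC_eqV (hw : WfV M fam) : sC fam = ((famT fam).map wc).sum := agg_sum_eqV hw _ _ (shOfV_wC M)
/-- `sab` -/ theorem sab_eqV (hw : WfV M fam) : sab fam = pabM (famT fam) := agg_sum_eqV hw _ _ (shOfV_ab M)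
/-- `sbc` -/ theorem sbc_eqV (hw : WfV M fam) : sbc fam = pbcM (famT fam) := agg_sum_eqV hw _ _ (shOfV_bc M)
/-- `sca` -/ theorem sca_eqV (hw : WfV M fam) : sca fam = pcaM (famT fam) := agg_sum_eqV hw _ _ (shOfV_ca M)
/-- `svL` -/ theorem sv_eqV (hw : WfV M fam) : svL fam = svM (famT fam) := agg_sum_eqV hw _ _ (shOfV_V M)
/-- `laL` -/ theorem la_eqV (hw : WfV M fam) : laL fam = laM (famT fam) := agg_sum_eqV hw _ _ (fun _ => rfl)
/-- `lbL` -/ theorem lb_eqV (hw : WfV M fam) : lbL fam = lbM (famT fam) := agg_sum_eqV hw _ _ (fun _ => rfl)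
/-- `lcL` -/ theorem lc_eqV (hw : WfV M fam) : lcL fam = lcM (famT fam) := agg_sum_eqV hw _ _ (fun _ => rfl)

/-- a mapped record field is below the `foldr max 0` of the mapped prefix -/
theorem le_foldr_max_map (f : Sh → ℕ) : ∀ (l : List Sh) (t : Sh), t ∈ l → f t ≤ (l.map f).foldr max 0
  | [], _, h => absurd h List.not_mem_nil
  | s :: l, t, h => by
    rw [List.map_cons, List.foldr_cons]
    rcases List.mem_cons.mp h with rfl | h
    · exact le_max_left _ _
    · exact (le_foldr_max_map f l t h).trans (le_max_right _ _)

/-- every `a` of the prefix is below `mxaL` -/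
theorem le_mxaL {t : Sh} (ht : t ∈ fam) : t.a ≤ mxaL fam := le_foldr_max_map (·.a) fam t ht
/-- every `b` of the prefix is below `mxbL` -/
theorem le_mxbL {t : Sh} (ht : t ∈ fam) : t.b ≤ mxbL fam := le_foldr_max_map (·.b) fam t ht
/-- every `c` of the prefix is below `mxcL` -/
theorem le_mxcL {t : Sh} (ht : t ∈ fam) : t.c ≤ mxcL fam := le_foldr_max_map (·.c) fam t ht

/-- aggregates of an extended prefix, incrementally -/
theorem aggV_cons (M : ℕ) (t : Sh) (fam : List Sh) : aggV M (t :: fam) = (aggV M fam).push t := by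
  simp [aggV, AggV.push, aggOf, Agg.push, gs, sA, sB, sC, sab, sbc, sca, dAB, dBC, dCA, mxP, mxV, mnA, mnB, mnC,
    svL, laL, lbL, lcL, mxaL, mxbL, mxcL]

/-- the eng-2 part of the aggregate record -/
@[simp] theorem aggV_A (M : ℕ) (fam : List Sh) : (aggV M fam).A = aggOf M fam := rfl

end aggregates

section universe_lemmas
/-! ### The universe: well formed, inside `InUniv`, complete -/
variable {M : ℕ}

/-- the generated universe is well formed and inside `InUniv` -/
theorem mem_univ0V {t : Sh} (ht : t ∈ univ0V M) : t = shOfV M t.tr ∧ InUniv M t.tr := by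
  unfold univ0V at ht
  simp only [List.mem_flatMap, List.mem_filterMap, List.mem_range, Sh.force_eq,
    Option.ite_none_right_eq_some, Option.some.injEq] at ht
  obtain ⟨a', -, b', -, c', -, hin, rfl⟩ := ht
  exact ⟨rfl, hin⟩

/-- **Completeness** of the generated universe -/
theorem shOfV_mem_univ0V {x : ℕ × ℕ × ℕ} (hx : InUniv M x) : shOfV M x ∈ univ0V M := by
  obtain ⟨ha, hb, hc⟩ := hx.pos
  have hv := hx.vol_le
  have hab : x.2.1 * x.1 ≤ M := by
    have h1 := hx.pab_le_vol; unfold pab vol at *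
    have : x.1 * x.2.1 * x.2.2 ≤ M := le_trans (Nat.le_add_right _ _) hv
    nlinarith
  have habc : x.2.2 * (x.1 * x.2.1) ≤ M := by
    unfold vol at hv
    have e : x.2.2 * (x.1 * x.2.1) = x.1 * x.2.1 * x.2.2 := by ring
    have := Nat.le_add_right (x.1 * x.2.1 * x.2.2) (max x.1 (max x.2.1 x.2.2))
    rw [e]; exact this.trans hv
  unfold univ0V
  simp only [List.mem_flatMap, List.mem_filterMap, List.mem_range, Sh.force_eq,
    Option.ite_none_right_eq_some, Option.some.injEq]
  refine ⟨x.1 - 1, by have := hx.a_le; omega, x.2.1 - 1, ?_, x.2.2 - 1, ?_, ?_, ?_⟩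
  · rw [Nat.sub_add_cancel ha]
    exact Nat.lt_of_lt_of_le (Nat.sub_lt hb one_pos) ((Nat.le_div_iff_mul_le ha).mpr hab)
  · rw [Nat.sub_add_cancel ha, Nat.sub_add_cancel hb]
    exact Nat.lt_of_lt_of_le (Nat.sub_lt hc one_pos) ((Nat.le_div_iff_mul_le (Nat.mul_pos ha hb)).mpr habc)
  · rw [Nat.sub_add_cancel ha, Nat.sub_add_cancel hb, Nat.sub_add_cancel hc]; exact hx
  · rw [Nat.sub_add_cancel ha, Nat.sub_add_cancel hb, Nat.sub_add_cancel hc]; rfl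

/-- binning keys are at most `M` -/
theorem shOfV_lev_lt {x : ℕ × ℕ × ℕ} (hx : InUniv M x) : (shOfV M x).lev < M + 1 := by
  rw [shOfV_lev]; have := hx.vol_le; omega

/-- the ordered universe is well formed and inside `InUniv` -/
theorem mem_univV {t : Sh} (ht : t ∈ univV M) : t = shOfV M t.tr ∧ InUniv M t.tr := by
  unfold univV binsV at ht
  rw [List.mem_flatten] at ht
  obtain ⟨b, hb, htb⟩ := ht
  rw [List.mem_reverse] at hb
  have : t ∈ ((univ0V M).foldl (fun bs s => addBin bs s.lev s) (List.replicate (M + 1) [])).flatten :=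
    List.mem_flatten.mpr ⟨b, hb, htb⟩
  rcases fold_sub _ _ _ this with h | h
  · simp at h
  · exact mem_univ0V h

/-- the ordered universe is well formed -/
theorem univV_wf (M : ℕ) : WfV M (univV M) := fun _ ht => (mem_univV ht).1

/-- the ordered universe lies inside `InUniv` -/
theorem univV_inUniv (M : ℕ) : ∀ t ∈ univV M, InUniv M t.tr := fun _ ht => (mem_univV ht).2

/-- **Completeness** of the ordered universe -/
theorem shOfV_mem_univV {x : ℕ × ℕ × ℕ} (hx : InUniv M x) : shOfV M x ∈ univV M := by
  have h0 := shOfV_mem_univ0V hx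
  have : shOfV M x ∈ ((univ0V M).foldl (fun bs s => addBin bs s.lev s) (List.replicate (M + 1) [])).flatten := by
    apply fold_complete
    · intro s hs; rw [List.length_replicate, (mem_univ0V hs).1]; exact shOfV_lev_lt (mem_univ0V hs).2
    · exact Or.inr h0
  unfold univV binsV
  obtain ⟨b, hb, hsb⟩ := List.mem_flatten.mp this
  exact List.mem_flatten.mpr ⟨b, List.mem_reverse.mpr hb, hsb⟩

end universe_lemmas

section decoration
/-! ### The decorated pool -/

/-- the decoration at the head of `sufDec (s :: rest)` -/
def dvec (s : Sh) (rest : List Sh) : Dec :=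
  let d := headD (sufDec rest)
  ⟨⟨bmax s d.B 0, bmax s d.B 1, bmax s d.B 2, bmax s d.B 3, bmax s d.B 4, bmax s d.B 5, bmax s d.B 6, bmax s d.B 7⟩,
    max s.a d.ma, max s.b d.mb, max s.c d.mc⟩

/-- one step of the decoration -/
theorem sufDec_cons (s : Sh) (rest : List Sh) : sufDec (s :: rest) = (s, dvec s rest) :: sufDec rest := by
  simp only [sufDec, seqN_eq, dvec]

/-- components of the head bucket vector -/
theorem dvec_get (s : Sh) (rest : List Sh) (k : ℕ) :
    (dvec s rest).B.get k = bmax s (headD (sufDec rest)).B (min k 7) := by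
  rcases Nat.lt_or_ge k 7 with hk | hk
  · interval_cases k <;> rfl
  · rw [B8.get_ge7 _ hk, min_eq_right hk]; rfl

/-- the head vector dominates the ratio of every pool shape whose volume fits the bucket -/
theorem sufDec_dom : ∀ (R : List Sh) (t : Sh), t ∈ R → ∀ k, capOK k t.V = true → t.rho ≤ (headD (sufDec R)).B.get k
  | [], t, ht, _, _ => absurd ht List.not_mem_nil
  | s :: rest, t, ht, k, hk => by
    rw [sufDec_cons]; simp only [headD]
    rw [dvec_get]; unfold bmax
    rcases List.mem_cons.mp ht with rfl | ht'
    · rw [← capOK_min7] at hk; rw [if_pos hk]; exact le_max_left _ _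
    · exact (sufDec_dom rest t ht' (min k 7) (by rwa [capOK_min7])).trans (le_max_right _ _)

/-- **the side decoration is sound** (rider D-R1 (iv)): the head decoration dominates the three sides of every pool shape -/
theorem sufDec_side : ∀ (R : List Sh) (t : Sh), t ∈ R →
    t.a ≤ (headD (sufDec R)).ma ∧ t.b ≤ (headD (sufDec R)).mb ∧ t.c ≤ (headD (sufDec R)).mc
  | [], t, ht => absurd ht List.not_mem_nil
  | s :: rest, t, ht => by
    rw [sufDec_cons]; simp only [headD, dvec]
    rcases List.mem_cons.mp ht with rfl | ht'
    · exact ⟨le_max_left _ _, le_max_left _ _, le_max_left _ _⟩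
    · obtain ⟨h1, h2, h3⟩ := sufDec_side rest t ht'
      exact ⟨h1.trans (le_max_right _ _), h2.trans (le_max_right _ _), h3.trans (le_max_right _ _)⟩

/-- every side of a pool shape is below `ms` of the head decoration -/
theorem sufDec_ms {R : List Sh} {t : Sh} (ht : t ∈ R) :
    t.a ≤ (headD (sufDec R)).ms ∧ t.b ≤ (headD (sufDec R)).ms ∧ t.c ≤ (headD (sufDec R)).ms := by
  obtain ⟨h1, h2, h3⟩ := sufDec_side R t ht
  unfold Dec.ms
  exact ⟨h1.trans (le_max_left _ _), h2.trans ((le_max_left _ _).trans (le_max_right _ _)),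
    h3.trans ((le_max_right _ _).trans (le_max_right _ _))⟩

end decoration

section cores
/-! ### The completion-budget cores on multisets (transcriptions of `VPBudget.u11G_budget_core` / `u11P_budget_core`) -/
variable {M t : ℕ} {F : Multiset (ℕ × ℕ × ℕ)}

/-- with every middle size below `t`, the ceiling head is `Σ V` -/
theorem ubBM_eq_of_lt (hb : ∀ x ∈ F, x.2.1 < t) : ubBM M F t = svM F + t * (M - pcaM F) := by
  unfold ubBM svM
  congr 1
  congr 1
  refine Multiset.map_congr rfl fun x hx => ?_
  rw [min_eq_right (hb x hx).le]; unfold vol; ring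

/-- with every middle size below `t`, the fibre count is the full fibre sum -/
theorem lBM_eq_of_lt (hb : ∀ x ∈ F, x.2.1 < t) : lBM F t = lbM F := by
  unfold lBM lbM; congr 1
  exact Multiset.map_congr rfl fun x hx => by rw [if_pos (hb x hx)]

/-- `Σ V ≤ (t − 1) · P_CA` when every middle size is below `t` -/
theorem svM_le_of_lt (hb : ∀ x ∈ F, x.2.1 < t) : svM F ≤ (t - 1) * pcaM F := by
  unfold svM pcaM
  rw [← Multiset.sum_map_mul_left]
  refine Multiset.sum_map_le_sum_map _ _ fun x hx => ?_
  have : x.2.1 ≤ t - 1 := Nat.le_sub_one_of_lt (hb x hx)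
  unfold vol pca
  calc x.1 * x.2.1 * x.2.2 = x.2.1 * (x.2.2 * x.1) := by ring
    _ ≤ (t - 1) * (x.2.2 * x.1) := Nat.mul_le_mul_right _ this

/-- **U11-G budget core** on a multiset (form B): `t·U + 1 ≤ 2t² + t·M + ΣV` -/
theorem budget_coreG (hF : U11GFormBM M F) (hca : pcaM F ≤ M) (h3 : 3 ≤ t) (hab : t ≤ pabM F)
    (hbc : t ≤ pbcM F) (hl : t ≤ lBM F t) (hb : ∀ x ∈ F, x.2.1 < t) :
    t * (pabM F + pbcM F + pcaM F) + 1 ≤ 2 * t ^ 2 + t * M + svM F := by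
  have h := (hF t (by omega) hab hbc hl).2 h3
  rw [ubBM_eq_of_lt hb] at h
  have hsub : t * (M - pcaM F) = t * M - t * pcaM F := mul_tsub t M (pcaM F)
  have hle : t * pcaM F ≤ t * M := Nat.mul_le_mul_left t hca
  have hdist : t * (pabM F + pbcM F + pcaM F) = t * (pabM F + pbcM F) + t * pcaM F := by ring
  omega

/-- **U11-P budget core** on a multiset (form B, prime order `M`): `t·U ≤ t² + t·M + ΣV` -/
theorem budget_coreP (hP : U11PFormBM M F) (hca : pcaM F ≤ M) (hpos : 1 ≤ pcaM F) (h1 : 1 ≤ t)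
    (hab : t ≤ pabM F) (hbc : t ≤ pbcM F) (hb : ∀ x ∈ F, x.2.1 < t) :
    t * (pabM F + pbcM F + pcaM F) ≤ t ^ 2 + t * M + svM F := by
  have h := hP t h1 hab hbc
  rw [ubBM_eq_of_lt hb] at h
  have hsv := svM_le_of_lt hb
  have hle : t * pcaM F ≤ t * M := Nat.mul_le_mul_left t hca
  have hsub : t * (M - pcaM F) = t * M - t * pcaM F := mul_tsub t M (pcaM F)
  have hsv' : svM F + pcaM F ≤ t * pcaM F := by
    have hm : (t - 1) * pcaM F + pcaM F = t * pcaM F := by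
      obtain ⟨s, rfl⟩ := Nat.exists_eq_add_of_le h1
      simp [Nat.add_mul, Nat.add_comm]
    omega
  have hdist : t * (pabM F + pbcM F + pcaM F) = t * (pabM F + pbcM F) + t * pcaM F := by ring
  have hsub2 : t * (pabM F + pbcM F - t) = t * (pabM F + pbcM F) - t * t := mul_tsub t _ t
  have htt : t * t ≤ t * (pabM F + pbcM F) := Nat.mul_le_mul_left t (by omega)
  have hsq : t ^ 2 = t * t := sq t
  rcases Nat.lt_or_ge (pabM F + pbcM F - t) M with hbr | hbr
  · rw [min_eq_right hbr.le] at h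
    omega
  · rw [min_eq_left hbr] at h
    omega

/-! letter rotations of the aggregates -/

/-- `P_AB` of the `rotA` family is `P_CA` -/
theorem pabM_rotA (F : Multiset (ℕ × ℕ × ℕ)) : pabM (F.map rotA) = pcaM F := by
  unfold pabM pcaM; rw [Multiset.map_map]; rfl
/-- `P_BC` of the `rotA` family is `P_AB` -/
theorem pbcM_rotA (F : Multiset (ℕ × ℕ × ℕ)) : pbcM (F.map rotA) = pabM F := by
  unfold pbcM pabM; rw [Multiset.map_map]; rfl
/-- `P_CA` of the `rotA` family is `P_BC` -/
theorem pcaM_rotA (F : Multiset (ℕ × ℕ × ℕ)) : pcaM (F.map rotA) = pbcM F := by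
  unfold pcaM pbcM; rw [Multiset.map_map]; rfl
/-- `Σ V` is rotation invariant (`rotA`) -/
theorem svM_rotA (F : Multiset (ℕ × ℕ × ℕ)) : svM (F.map rotA) = svM F := by
  unfold svM; rw [Multiset.map_map]; congr 1
  exact Multiset.map_congr rfl fun x _ => by unfold vol rotA; simp only [Function.comp_apply]; ring
/-- the full fibre sum of the `rotA` family is `laM` -/
theorem lbM_rotA (F : Multiset (ℕ × ℕ × ℕ)) : lbM (F.map rotA) = laM F := by
  unfold lbM laM; rw [Multiset.map_map]; rfl
/-- `P_AB` of the `rotC` family is `P_BC` -/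
theorem pabM_rotC (F : Multiset (ℕ × ℕ × ℕ)) : pabM (F.map rotC) = pbcM F := by
  unfold pabM pbcM; rw [Multiset.map_map]; rfl
/-- `P_BC` of the `rotC` family is `P_CA` -/
theorem pbcM_rotC (F : Multiset (ℕ × ℕ × ℕ)) : pbcM (F.map rotC) = pcaM F := by
  unfold pbcM pcaM; rw [Multiset.map_map]; rfl
/-- `P_CA` of the `rotC` family is `P_AB` -/
theorem pcaM_rotC (F : Multiset (ℕ × ℕ × ℕ)) : pcaM (F.map rotC) = pabM F := by
  unfold pcaM pabM; rw [Multiset.map_map]; rfl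
/-- `Σ V` is rotation invariant (`rotC`) -/
theorem svM_rotC (F : Multiset (ℕ × ℕ × ℕ)) : svM (F.map rotC) = svM F := by
  unfold svM; rw [Multiset.map_map]; congr 1
  exact Multiset.map_congr rfl fun x _ => by unfold vol rotC; simp only [Function.comp_apply]; ring
/-- the full fibre sum of the `rotC` family is `lcM` -/
theorem lbM_rotC (F : Multiset (ℕ × ℕ × ℕ)) : lbM (F.map rotC) = lcM F := by
  unfold lbM lcM; rw [Multiset.map_map]; rfl

/-- `3V ≤ m · (ab + bc + ca)` when every side is at most `m` -/
theorem three_vol_le {x : ℕ × ℕ × ℕ} {m : ℕ} (h1 : x.1 ≤ m) (h2 : x.2.1 ≤ m) (h3 : x.2.2 ≤ m) :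
    3 * vol x ≤ m * uu x := by
  unfold vol uu pab pbc pca
  have e : m * (x.1 * x.2.1 + x.2.1 * x.2.2 + x.2.2 * x.1) =
      x.1 * x.2.1 * m + m * (x.2.1 * x.2.2) + x.2.2 * m * x.1 := by ring
  rw [e]
  have a1 : x.1 * x.2.1 * x.2.2 ≤ x.1 * x.2.1 * m := Nat.mul_le_mul_left _ h3
  have a2 : x.1 * x.2.1 * x.2.2 ≤ m * (x.2.1 * x.2.2) := by
    rw [mul_assoc]; exact Nat.mul_le_mul_right _ h1
  have a3 : x.1 * x.2.1 * x.2.2 ≤ x.2.2 * m * x.1 := by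
    calc x.1 * x.2.1 * x.2.2 = x.2.2 * x.2.1 * x.1 := by ring
      _ ≤ x.2.2 * m * x.1 := Nat.mul_le_mul_right _ (Nat.mul_le_mul_left _ h2)
  omega

end cores

section arith
/-! ### Arithmetic of the completion budget -/

/-- the arithmetic of the budget: from the core inequality over the family split as prefix + tail -/
theorem uu_le_div {t ms Uf Ut Sf St N : ℕ} (hms : ms < 3 * t) (hcore : t * Uf + t * Ut + N ≤ Sf + St)
    (hsv : 3 * St ≤ ms * Ut) : Ut ≤ 3 * (Sf - (t * Uf + N)) / (3 * t - ms) := by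
  obtain ⟨k, hk⟩ := Nat.exists_eq_add_of_lt hms
  have hk' : 3 * t - ms = k + 1 := by omega
  rw [Nat.le_div_iff_mul_le (by omega), hk', Nat.mul_comm Ut (k + 1)]
  have e1 : 3 * (t * Ut) = ms * Ut + (k + 1) * Ut := by
    rw [← Nat.add_mul, show ms + (k + 1) = 3 * t by omega]; ring
  omega

/-- the budget fold only ever decreases towards valid bounds -/
theorem le_budget_fold {X : ℕ} (isP : Bool) (okP okG : ℕ → Bool) (fP fG : ℕ → ℕ)
    (hP : ∀ t, isP = true → okP t = true → X ≤ fP t) (hG : ∀ t, isP = false → okG t = true → X ≤ fG t) :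
    ∀ (l : List ℕ) (q : ℕ), X ≤ q →
      X ≤ l.foldl (fun q t => if isP then (if okP t then min q (fP t) else q)
        else (if okG t then min q (fG t) else q)) q
  | [], q, hq => hq
  | t :: l, q, hq => by
    rw [List.foldl_cons]
    apply le_budget_fold isP okP okG fP fG hP hG l
    cases hi : isP <;> simp only [Bool.false_eq_true, if_false, if_true]
    · by_cases ho : okG t = true
      · rw [if_pos ho]; exact le_min hq (hG t hi ho)
      · rw [if_neg ho]; exact hq
    · by_cases ho : okP t = true
      · rw [if_pos ho]; exact le_min hq (hP t hi ho)
      · rw [if_neg ho]; exact hq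

end arith

end Summit.MatrixMultiplication.MatrixMultiplication.Theorems.VPCert
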